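import Mathlib
import HarnessLib
import Literature.Analysis.FluidPDE.SereginSverakPressureLocalTypeI
import Literature.Analysis.FluidPDE.BlowupFarField
import Summits.NavierStokesRegularity.NavierStokesRegularity.Theorems.TypeIQuarterGateScarZoomDefs
import Summits.NavierStokesRegularity.NavierStokesRegularity.Theorems.TypeIQuarterGateSliceBudgetDefs
import Summits.NavierStokesRegularity.NavierStokesRegularity.Theorems.TypeIQuarterGateScarEnvelopeTypeIBudgetZoomLimit
import Summits.NavierStokesRegularity.NavierStokesRegularity.Theorems.TypeIQuarterGateScarEnvelopeTypeIScarZoom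
import Summits.NavierStokesRegularity.NavierStokesRegularity.Theorems.TypeICertificateLadderNoTypeIBlowupTypeIMorrey

/-!
# Line `slice_budget` on crux `TypeIQuarterGate.ScarEnvelopeTypeI` (stmt-NavierStokesRegularity-23843) —
# STUB B `stub_tameScarZoom`: envelope violators at a scar of a solution carrying the slice-wise
# octave budget zoom to a TAME TWIN-SCAR OBJECT (second scar in the ESS class)

The stub `stub_tameScarZoom` of the line file `Cruxes/ScarEnvelopeTypeI/Lines/slice_budget.lean`
(line owner ns-idea-7 g2, critic idea-crit-7 PASS-WITH-PRICE 2026-08-28T06:13:26Z) proved VERBATIM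
and UNCONDITIONALLY:

  `CruxHypotheses ν T u p → OctaveBudget ν T u → ScarViolators T u → ∃ M v, TameTwinScar M v`.

Proof (every input a kernel-checked tree theorem; steps 1–5 are those of the landed
`ScarZoom.stub_scarZoom`, p610713).
1. `morrey_of_typeI` and `exists_zoom_typeIBound_lt_top_of_morrey` (A–B Lemma 2.6): the
   viscosity-normalising zoom `v = α u(T + β·, a + R·)` about the scar, `β = R²/ν`, `α = R/ν`, is
   a suitable weak solution in `Q(0, 1)` of Albritton–Barker's class with `𝐈(Q(0, 1/2)) < ∞`;
   the rate on a final window from `exists_typeI_rate_window`.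
2. The violators make `(T, a)` a genuine singular point — the origin is backward singular for `v`
   — and a `SingularPt` of the line, so `OctaveBudget` applies at `a` with some `q, δ, r₀`.
3. THE BUDGET IS SCALE INVARIANT: since `ν β = R²`, the admissibility condition
   `√(ν(T − t)) ≤ ℓ` becomes `√(−s) ≤ ℓ'` for `v` (`t = T + βs`, `ℓ = Rℓ'`), and
   `∫_{ℓ'<|y|<eℓ'} |v(s)|³ = (α/R)³ ∫_{ℓ<|x−a|<eℓ} |u(t)|³ ≤ q/ν³` (`space_affine_preimage_annulus`,
   `setLIntegral_preimage_comp_space_affine`).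
4. The twin zoom with budget (file 3, `exists_typeIAncientMild_twinZoomLimit_budget`): scales
   `‖x_k − a‖/R`, satellites `(x_k − a)/‖x_k − a‖ → e ∈ S²`, zoomed times `→ 0⁻`, values `→ ∞`.
   Output: `U ∈ IsTypeIAncientMild C₁`, in Albritton–Barker's class on every `Q(0, R')`, backward
   singular at `0` and at `(0, e)`, and `∫_{B(e,½)} |U(s)|³ ≤ 2q/ν³` for a.e. `s ∈ (−¼, 0)`.
5. `ESSClassAt U e` (`essClassAt_of_inBall_of_budget`): restrict the class to `Q((0,e), ½)`
   (`IsSuitableWeakSolutionInBall.of_subset_zero`), zoom by `λ = ½` about `(0, e)`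
   (`IsSuitableWeakSolutionInBall.zoom`), which is literally `essTranslate U e` with the zoomed
   pressure: distributional Navier–Stokes, `L^∞L²`, gradient in `L²`, pressure in `L^{3/2}` on the
   unit cylinder; the `L^∞L³` clause is the transported budget (`ae_sliced_setLIntegral_ball_stRescale`).
   `SingularAt` at both points by `ScarZoom.singularAt_of_isBackwardSingularPoint`.

No statement about the crux `ScarEnvelopeTypeI`, its parent `QuarterLawTypeI` or the summit is
proved by this file: the line's deciding stub `stub_sliceOctaveBudget` (the budget itself) stays open.
-/

noncomputable section

-- the summit-side namespace `Summit.NavierStokesRegularity.NavierStokesRegularity.…` (single-conjunct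
-- summit, D-0017) repeats a component by design; the dupNamespace linter would flag every declaration.
set_option linter.dupNamespace false

namespace Summit.NavierStokesRegularity.NavierStokesRegularity.Cruxes.ScarEnvelopeTypeI.SliceBudget

open MeasureTheory Set Function Filter Topology TopologicalSpace Metric
open scoped NNReal ENNReal
open Literature.Analysis Literature.Analysis.FluidPDE
open Summit.NavierStokesRegularity.NavierStokesRegularity.Cruxes.ScarEnvelopeTypeI.ScarZoom
  (CruxHypotheses ScarViolators SingularAt singularAt_of_isBackwardSingularPoint)

local notation "E3" => EuclideanSpace ℝ (Fin 3)

/-! ### Tool: the ESS class at `e` from the Albritton–Barker class and the slice budget -/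

/-- **The ESS class at the second scar.**  If `(U, P)` is in Albritton–Barker's class on `Q(0, 2)`
and `∫_{B(e,½)} |U(s)|³ ≤ B < ∞` for a.e. `s ∈ (−¼, 0)`, `‖e‖ = 1`, then `ESSClassAt U e`: the
class restricts to `Q((0,e), ½) ⊆ Q(0, 2)` and zooms by `λ = ½` about `(0, e)` to the class on the
unit cylinder of `essTranslate U e` (distributional equations, `L^∞L²`, gradient, pressure
`L^{3/2}`), and the budget zooms to the `L^∞L³` clause. -/
theorem essClassAt_of_inBall_of_budget {U : ℝ → E3 → E3} {P : ℝ → E3 → ℝ} {e : E3} {B : ℝ≥0∞}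
    (hB : B ≠ ⊤) (hball : IsSuitableWeakSolutionInBall 2 0 U P)
    (hbud : ∀ᵐ s ∂(volume.restrict (Ioo (-(1 / 4 : ℝ)) 0)),
      ∫⁻ y in ball e (1 / 2), ‖U s y‖ₑ ^ (3 : ℝ) ≤ B)
    (he : ‖e‖ = 1) : ESSClassAt U e := by
  -- the class on `Q((0,e), 1/2)` and its zoom to the unit cylinder
  have hsub : parabolicCylinder (1 / 2) (((0 : ℝ), e) : ℝ × E3) ⊆ parabolicCylinder 2 (0 : ℝ × E3) := by
    intro w hw
    rw [mem_parabolicCylinder] at hw ⊢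
    simp only [Prod.fst_zero, Prod.snd_zero, zero_sub] at hw ⊢
    obtain ⟨⟨h1, h2⟩, h3⟩ := hw
    refine ⟨⟨by linarith, h2⟩, ?_⟩
    calc dist w.2 0 ≤ dist w.2 e + dist e 0 := dist_triangle _ _ _
      _ < 1 / 2 + 1 := by rw [dist_zero_right, he]; linarith
      _ ≤ 2 := by norm_num
  have hz := (hball.of_subset_zero (by norm_num) hsub).zoom (by norm_num : (0 : ℝ) < 1 / 2)
  have hess : essTranslate U e = (1 / 2 : ℝ) •
      stPull ((1 / 2 : ℝ) ^ 2) (1 / 2) (((0 : ℝ), e) : ℝ × E3).1 (((0 : ℝ), e) : ℝ × E3).2 U := by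
    funext s y
    show (1 / 2 : ℝ) • U (s / 4) (e + (1 / 2 : ℝ) • y) =
      (1 / 2 : ℝ) • U (0 + (1 / 2 : ℝ) ^ 2 * s) (e + (1 / 2 : ℝ) • y)
    rw [show (0 : ℝ) + (1 / 2 : ℝ) ^ 2 * s = s / 4 by ring]
  obtain ⟨hsuit, ⟨C2, hC2⟩, ⟨G, hG, hG2⟩, hp⟩ := hz
  refine ⟨(1 / 2 : ℝ) ^ 2 •
      stPull ((1 / 2 : ℝ) ^ 2) (1 / 2) (((0 : ℝ), e) : ℝ × E3).1 (((0 : ℝ), e) : ℝ × E3).2 P,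
    ?_, ⟨C2, ?_⟩, ⟨G, ?_, hG2⟩, ?_, ?_⟩
  · -- distributional Navier–Stokes on the unit cylinder
    rw [hess]
    exact hsuit.distributional
  · -- `L^∞ L²`
    have hset : Ioo ((0 : ℝ × E3).1 - 1 ^ 2) (0 : ℝ × E3).1 = Ioo (-1 : ℝ) 0 := by simp
    rw [hset] at hC2
    rw [hess]
    exact hC2
  · -- the weak gradient
    rw [hess]
    exact hG
  · -- the pressure class
    have h32 : ((3 : ℝ≥0∞) / 2).toReal = 3 / 2 := by
      rw [ENNReal.toReal_div]; norm_num
    have h32top : (3 : ℝ≥0∞) / 2 ≠ ⊤ := (ENNReal.div_lt_top (by simp) (by simp)).ne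
    have h2 := hp.eLpNorm_lt_top
    rw [eLpNorm_eq_lintegral_rpow_enorm_toReal (by norm_num) h32top, h32] at h2
    exact (ENNReal.rpow_lt_top_iff_of_pos (by norm_num : (0 : ℝ) < 1 / (3 / 2))).1 h2
  · -- `L^∞ L³` from the transported budget
    have h1 : ∀ᵐ t ∂(volume.restrict (Ioo ((0 : ℝ) + (1 / 2 : ℝ) ^ 2 * (-1))
        ((0 : ℝ) + (1 / 2 : ℝ) ^ 2 * 0))), ∫⁻ x in ball e (1 / 2), ‖U t x‖ₑ ^ (3 : ℝ) ≤ B := by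
      have hset : Ioo ((0 : ℝ) + (1 / 2 : ℝ) ^ 2 * (-1)) ((0 : ℝ) + (1 / 2 : ℝ) ^ 2 * 0) =
          Ioo (-(1 / 4 : ℝ)) 0 := by norm_num
      rw [hset]
      exact hbud
    have h2 := ae_sliced_setLIntegral_ball_stRescale (pow_pos (by norm_num : (0 : ℝ) < 1 / 2) 2)
      (by norm_num : (0 : ℝ) < 1 / 2) (0 : ℝ) e e (1 / 2) (-1) 0 (fun t x => ‖U t x‖ₑ ^ (3 : ℝ)) h1
    rw [finrank_euclideanSpace_fin, sub_self, smul_zero, div_self (by norm_num : (1 / 2 : ℝ) ≠ 0)]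
      at h2
    set C₁ : ℝ≥0∞ := ‖(1 / 2 : ℝ)‖ₑ ^ 3 * (ENNReal.ofReal ((1 / 2 : ℝ) ^ 3)⁻¹ * B) with hC₁
    have hC₁top : C₁ ≠ ⊤ :=
      ENNReal.mul_ne_top (ENNReal.pow_ne_top enorm_ne_top)
        (ENNReal.mul_ne_top ENNReal.ofReal_ne_top hB)
    refine ⟨C₁.toNNReal, ?_⟩
    rw [ENNReal.coe_toNNReal hC₁top]
    filter_upwards [h2] with s hs
    have e3 : ∀ x : E3, ‖essTranslate U e s x‖ₑ ^ 3 =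
        ‖(1 / 2 : ℝ)‖ₑ ^ 3 * ‖U (0 + (1 / 2 : ℝ) ^ 2 * s) (e + (1 / 2 : ℝ) • x)‖ₑ ^ (3 : ℝ) := by
      intro x
      have hx : essTranslate U e s x = (1 / 2 : ℝ) • U (0 + (1 / 2 : ℝ) ^ 2 * s) (e + (1 / 2 : ℝ) • x) := by
        show (1 / 2 : ℝ) • U (s / 4) (e + (1 / 2 : ℝ) • x) = _
        rw [show (0 : ℝ) + (1 / 2 : ℝ) ^ 2 * s = s / 4 by ring]
      rw [hx, enorm_smul, mul_pow]
      congr 1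
      rw [← ENNReal.rpow_natCast]
      norm_num
    calc ∫⁻ x in ball (0 : E3) 1, ‖essTranslate U e s x‖ₑ ^ 3
        = ∫⁻ x in ball (0 : E3) 1,
            ‖(1 / 2 : ℝ)‖ₑ ^ 3 * ‖U (0 + (1 / 2 : ℝ) ^ 2 * s) (e + (1 / 2 : ℝ) • x)‖ₑ ^ (3 : ℝ) :=
          lintegral_congr fun x => e3 x
      _ = ‖(1 / 2 : ℝ)‖ₑ ^ 3 *
            ∫⁻ x in ball (0 : E3) 1, ‖U (0 + (1 / 2 : ℝ) ^ 2 * s) (e + (1 / 2 : ℝ) • x)‖ₑ ^ (3 : ℝ) :=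
          lintegral_const_mul' _ _ (ENNReal.pow_ne_top enorm_ne_top)
      _ ≤ ‖(1 / 2 : ℝ)‖ₑ ^ 3 * (ENNReal.ofReal ((1 / 2 : ℝ) ^ 3)⁻¹ * B) := mul_le_mul' le_rfl hs
      _ = C₁ := rfl

/-! ### STUB B -/

/-- **STUB B of line `slice_budget` (registered signature, verbatim).**  Under the crux hypotheses,
envelope violators at a scar of a solution with the slice-wise octave budget produce a TAME
TWIN-SCAR OBJECT: a Type-I ancient mild solution in the KNSS/Oseen gauge, singular at time `0` at
the origin and at a point `e` of the unit sphere at which it lies in the ESS class.  Proof: Morrey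
bound + viscosity-normalising zoom about the scar (A–B Lemma 2.6); the scar is a genuine singular
point (violators), so the budget applies there and, being scale invariant (`νβ = R²`), passes to
the normalised solution; twin zoom with budget (file 3) at the prescribed scales `‖x_k − a‖/R` with
the satellites `(x_k − a)/‖x_k − a‖`; the ESS class at `e` by the tool above.  See the module
docstring. -/
theorem stub_tameScarZoom :
    ∀ (ν T : ℝ) (u : ℝ → E3 → E3) (p : ℝ → E3 → ℝ),
      CruxHypotheses ν T u p → OctaveBudget ν T u → ScarViolators T u →
        ∃ (M : ℝ) (v : ℝ → E3 → E3), TameTwinScar M v := by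
  intro ν T u p hH hOB hV
  obtain ⟨hν, hT, hmax, hLH, -, hTI, -⟩ := hH
  obtain ⟨a, x, t, ht, hxa, ht_tend, hx_tend, hratio, hprod⟩ := hV
  have hsol := hmax.1
  -- ## (1) Morrey bound and the viscosity-normalising zoom about the scar `(T, a)`
  obtain ⟨r₀, M₀, T₁, hr₀, hT₁, hMor⟩ :=
    Summit.NavierStokesRegularity.NavierStokesRegularity.Theorems.morrey_of_typeI hν hT hsol hLH hTI
  obtain ⟨R, α, β, hR, hα, hβ, hβν, hαν, hβT, hball, hGv, htypeI⟩ :=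
    Summit.NavierStokesRegularity.NavierStokesRegularity.Theorems.exists_zoom_typeIBound_lt_top_of_morrey
      hν hT hsol hLH hr₀ hT₁ hMor a
  set q : ℝ → E3 → ℝ := fun t x => p t x - (p t 0 - normalisedPressure (u t) 0) with hq
  set v : ℝ → E3 → E3 := α • stPull β R T a u with hv
  set πv : ℝ → E3 → ℝ := α ^ 2 • stPull β R T a q with hπv
  set Gv : ℝ → E3 → E3 →L[ℝ] E3 := (α * R) • stPull β R T a (fun t x => fderiv ℝ (u t) x)
    with hGvdef
  have hνβ : ν * β = R ^ 2 := by rw [hβν]; field_simp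
  -- ## (2) the scar is a genuine singular point
  have hnorm : Tendsto (fun k => ‖u (t k) (x k)‖) atTop atTop := by
    have hdist : Tendsto (fun k => ‖x k - a‖) atTop (𝓝 0) :=
      tendsto_iff_norm_sub_tendsto_zero.1 hx_tend
    have hsmall : ∀ᶠ k in atTop, ‖x k - a‖ ≤ 1 :=
      hdist.eventually (Iic_mem_nhds one_pos)
    refine tendsto_atTop_mono' atTop ?_ hprod
    filter_upwards [hsmall] with k hk
    calc ‖x k - a‖ * ‖u (t k) (x k)‖ ≤ 1 * ‖u (t k) (x k)‖ :=
        mul_le_mul_of_nonneg_right hk (norm_nonneg _)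
      _ = ‖u (t k) (x k)‖ := one_mul _
  have hnotbd : ¬ IsBackwardBoundedAt u T a := by
    rintro ⟨r, hr, K, hK⟩
    have h1 : ∀ᶠ k in atTop, T - r ^ 2 < t k := ht_tend.eventually (lt_mem_nhds (by nlinarith))
    have h2 : ∀ᶠ k in atTop, x k ∈ ball a r := hx_tend.eventually_mem (ball_mem_nhds a hr)
    have h3 : ∀ᶠ k in atTop, K < ‖u (t k) (x k)‖ := hnorm.eventually (eventually_gt_atTop K)
    obtain ⟨k, hk1, hk2, hk3⟩ := (h1.and (h2.and h3)).exists
    exact absurd (hK (t k) ⟨hk1, (ht k).2⟩ (x k) hk2) (not_le.2 hk3)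
  have hsing : IsBackwardSingularPoint v (0 : ℝ × E3) := by
    intro r hr
    by_contra hfin
    have hfin' : eLpNorm (uncurry v) ⊤
        (volume.restrict (parabolicCylinder (min r 1) (0 : ℝ × E3))) < ⊤ := by
      refine lt_of_le_of_lt (eLpNorm_mono_measure _ (Measure.restrict_mono ?_ le_rfl))
        (lt_top_iff_ne_top.2 hfin)
      exact parabolicCylinder_mono (le_min hr.le zero_le_one) (min_le_left _ _) _
    exact hnotbd (SereginSverak2002.isBackwardBoundedAt_of_zoom hsol a hR hα hβ hβT
      (lt_min hr one_pos) (min_le_right _ _) hfin')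
  -- the scar is a `SingularPt` of the line, so the octave budget applies at `a`
  have hSingPt : SingularPt T u a := by
    intro r hr _ A
    have h1 : ∀ᶠ k in atTop, T - r ^ 2 < t k := ht_tend.eventually (lt_mem_nhds (by nlinarith))
    have h2 : ∀ᶠ k in atTop, x k ∈ ball a r := hx_tend.eventually_mem (ball_mem_nhds a hr)
    have h3 : ∀ᶠ k in atTop, A < ‖u (t k) (x k)‖ := hnorm.eventually (eventually_gt_atTop A)
    obtain ⟨k, hk1, hk2, hk3⟩ := (h1.and (h2.and h3)).exists
    exact ⟨t k, ⟨hk1, (ht k).2⟩, x k, hk2, hk3⟩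
  obtain ⟨qo, δb, r₀b, hδb, hr₀b, hbud⟩ := hOB a hSingPt
  -- ## (3) the budget is scale invariant: the normalised budget of `v` at the origin
  set qb : ℝ≥0∞ := ‖α‖ₑ ^ (3 : ℝ) * ENNReal.ofReal (R ^ 3)⁻¹ * ENNReal.ofReal qo with hqb
  have hqbtop : qb ≠ ⊤ :=
    ENNReal.mul_ne_top (ENNReal.mul_ne_top (ENNReal.rpow_ne_top_of_nonneg (by norm_num) enorm_ne_top)
      ENNReal.ofReal_ne_top) ENNReal.ofReal_ne_top
  have hbudv : ∀ t' ∈ Ioo ((0 : ℝ × E3).1 - δb / β) (0 : ℝ × E3).1, ∀ ℓ' : ℝ,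
      Real.sqrt ((0 : ℝ × E3).1 - t') ≤ ℓ' → ℓ' ≤ r₀b / R →
      ∫⁻ y in {y : E3 | ℓ' < ‖y - (0 : ℝ × E3).2‖ ∧ ‖y - (0 : ℝ × E3).2‖ < Real.exp 1 * ℓ'},
        ‖v t' y‖ₑ ^ (3 : ℝ) ≤ qb := by
    intro t' ht' ℓ' hℓ1 hℓ2
    simp only [Prod.fst_zero, Prod.snd_zero, sub_zero, zero_sub] at ht' hℓ1 ⊢
    rw [mem_Ioo] at ht'
    have e1 : ∀ y : E3, ‖v t' y‖ₑ ^ (3 : ℝ) =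
        ‖α‖ₑ ^ (3 : ℝ) * ‖u (T + β * t') (a + R • y)‖ₑ ^ (3 : ℝ) := by
      intro y
      rw [hv, smul_stPull_apply, enorm_smul, ENNReal.mul_rpow_of_nonneg _ _ (by norm_num)]
    simp_rw [e1]
    rw [lintegral_const_mul' _ _ (ENNReal.rpow_ne_top_of_nonneg (by norm_num) enorm_ne_top),
      ← space_affine_preimage_annulus hR a ℓ',
      setLIntegral_preimage_comp_space_affine hR a
        (fun x => ‖u (T + β * t') x‖ₑ ^ (3 : ℝ)) _,
      finrank_euclideanSpace_fin, ← mul_assoc, hqb]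
    refine mul_le_mul' le_rfl (hbud (T + β * t') ⟨?_, ?_⟩ (R * ℓ') ?_ ?_)
    · have h := mul_lt_mul_of_pos_left ht'.1 hβ
      rw [mul_neg, mul_div_cancel₀ _ hβ.ne'] at h
      linarith
    · linarith [mul_neg_of_pos_of_neg hβ ht'.2]
    · rw [show ν * (T - (T + β * t')) = R ^ 2 * (-t') by rw [← hνβ]; ring,
        Real.sqrt_mul (sq_nonneg _), Real.sqrt_sq hR.le]
      exact mul_le_mul_of_nonneg_left hℓ1 hR.le
    · rw [mul_comm]
      exact (le_div_iff₀ hR).1 hℓ2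
  -- ## (4) the rate of the zoom on a final window and the data on `Q(0, ρ')`
  obtain ⟨C, δ, hC0, hδ, -, hrate⟩ :=
    Summit.NavierStokesRegularity.NavierStokesRegularity.Theorems.exists_typeI_rate_window hT hTI
  set C₁ : ℝ := α * C / Real.sqrt β with hC₁def
  have hratev : ∀ s ∈ Ioo (-(δ / β)) 0, ∀ y, ‖v s y‖ ≤ C₁ / Real.sqrt (-s) := by
    intro s hs y
    have h1 : -δ < β * s := by
      have h := mul_lt_mul_of_pos_left hs.1 hβ
      rwa [mul_neg, mul_div_cancel₀ _ hβ.ne'] at h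
    have h2 : β * s < 0 := mul_neg_of_pos_of_neg hβ hs.2
    have hb := hrate (T + β * s) ⟨by linarith, by linarith⟩ (a + R • y)
    have hsq : Real.sqrt (T - (T + β * s)) = Real.sqrt β * Real.sqrt (-s) := by
      rw [show T - (T + β * s) = β * (-s) by ring, Real.sqrt_mul hβ.le]
    rw [hsq] at hb
    have hpos : 0 < Real.sqrt (-s) := Real.sqrt_pos.2 (by linarith [hs.2])
    have hposβ : 0 < Real.sqrt β := Real.sqrt_pos.2 hβ
    rw [hv, smul_stPull_apply, norm_smul, Real.norm_of_nonneg hα.le, hC₁def]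
    rw [div_div, le_div_iff₀ (by positivity)]
    calc α * ‖u (T + β * s) (a + R • y)‖ * (Real.sqrt β * Real.sqrt (-s))
        = α * (Real.sqrt β * Real.sqrt (-s) * ‖u (T + β * s) (a + R • y)‖) := by ring
      _ ≤ α * C := mul_le_mul_of_nonneg_left hb hα.le
  set ρ' : ℝ := min (1 / 2) (Real.sqrt (δ / β)) with hρ'def
  have hρ' : 0 < ρ' := lt_min (by norm_num) (Real.sqrt_pos.2 (div_pos hδ hβ))
  have hρ'half : ρ' ≤ 1 / 2 := min_le_left _ _
  have hρ'1 : ρ' ≤ 1 := hρ'half.trans (by norm_num)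
  have hρ'sq : ρ' ^ 2 ≤ δ / β := by
    have h1 : ρ' ≤ Real.sqrt (δ / β) := min_le_right _ _
    have := pow_le_pow_left₀ hρ'.le h1 2
    rwa [Real.sq_sqrt (div_pos hδ hβ).le] at this
  have hsub1 : parabolicCylinder ρ' (0 : ℝ × E3) ⊆ parabolicCylinder 1 (0 : ℝ × E3) :=
    parabolicCylinder_mono hρ'.le hρ'1 _
  have hsubh : parabolicCylinder ρ' (0 : ℝ × E3) ⊆ parabolicCylinder (1 / 2) (0 : ℝ × E3) :=
    parabolicCylinder_mono hρ'.le hρ'half _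
  have hball' : IsSuitableWeakSolutionInBall ρ' 0 v πv := hball.of_subset_zero hρ' hsub1
  have hGv' : HasWeakSpatialGradientOn (parabolicCylinderOpens ρ' (0 : ℝ × E3)) v Gv :=
    hGv.mono fun w hw => hsub1 hw
  have hI' : typeIBound (parabolicCylinder ρ' (0 : ℝ × E3)) v πv Gv < ⊤ :=
    lt_of_le_of_lt (typeIBound_mono hsubh) htypeI
  have hwin : ∀ w ∈ parabolicCylinder ρ' (0 : ℝ × E3), w.1 ∈ Ioo (-(δ / β)) 0 ∧
      T + β * w.1 ∈ Ico 0 T := by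
    intro w hw
    rw [mem_parabolicCylinder] at hw
    simp only [Prod.fst_zero, zero_sub] at hw
    obtain ⟨⟨h1, h2⟩, -⟩ := hw
    have h3 : -(δ / β) < w.1 := by linarith
    have hρ'sq1 : ρ' ^ 2 ≤ 1 := by nlinarith
    have h4 : β * ρ' ^ 2 ≤ β * 1 := mul_le_mul_of_nonneg_left hρ'sq1 hβ.le
    have h5 : β * (-ρ' ^ 2) < β * w.1 := mul_lt_mul_of_pos_left h1 hβ
    have h6 : β * w.1 < β * 0 := mul_lt_mul_of_pos_left h2 hβ
    refine ⟨⟨h3, h2⟩, ?_, by linarith⟩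
    linarith
  have hvc' : ContinuousOn (uncurry v) (parabolicCylinder ρ' (0 : ℝ × E3)) := by
    have hcontu : ContinuousOn (uncurry u) (Ico 0 T ×ˢ univ) := hsol.smooth_velocity.continuousOn
    have e : uncurry v = fun w => α • (uncurry u ∘ stAffine β R T a) w := by
      funext w
      rfl
    rw [e]
    refine ContinuousOn.const_smul (hcontu.comp (continuous_stAffine _ _ _ _).continuousOn ?_) α
    intro w hw
    rw [mem_prod, stAffine_fst]
    exact ⟨(hwin w hw).2, mem_univ _⟩
  have hrate' : ∀ (s : ℝ) (y : E3), (s, y) ∈ parabolicCylinder ρ' (0 : ℝ × E3) →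
      ‖v s y‖ ≤ C₁ / Real.sqrt ((0 : ℝ × E3).1 - s) := by
    intro s y hsy
    show ‖v s y‖ ≤ C₁ / Real.sqrt ((0 : ℝ) - s)
    rw [zero_sub]
    exact hratev s (hwin _ hsy).1 y
  -- ## (5) scales, satellites and the values at the satellites
  have hρpos : ∀ k, 0 < ‖x k - a‖ := fun k => norm_pos_iff.2 (sub_ne_zero.2 (hxa k))
  set Rz : ℕ → ℝ := fun k => ‖x k - a‖ / R with hRz
  have hRz_pos : ∀ k, 0 < Rz k := fun k => div_pos (hρpos k) hR
  have hRz0 : Tendsto Rz atTop (𝓝 0) := by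
    have h := (tendsto_iff_norm_sub_tendsto_zero.1 hx_tend).div_const R
    rwa [zero_div] at h
  set sN : ℕ → ℝ := fun k => (t k - T) / (β * Rz k ^ 2) with hsN
  have hsN_neg : ∀ k, sN k < 0 := fun k =>
    div_neg_of_neg_of_pos (by linarith [(ht k).2]) (mul_pos hβ (pow_pos (hRz_pos k) 2))
  have hsN0 : Tendsto sN atTop (𝓝 0) := by
    have e : ∀ k, sN k = -(R ^ 2 / β) * ((T - t k) / ‖x k - a‖ ^ 2) := by
      intro k
      have h1 : ‖x k - a‖ ≠ 0 := (hρpos k).ne'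
      simp only [hsN, hRz]
      field_simp
      ring
    rw [show sN = fun k => -(R ^ 2 / β) * ((T - t k) / ‖x k - a‖ ^ 2) from funext e]
    simpa using hratio.const_mul (-(R ^ 2 / β))
  set ηN : ℕ → E3 := fun k => ‖x k - a‖⁻¹ • (x k - a) with hηN
  have hηN_mem : ∀ k, ηN k ∈ sphere (0 : E3) 1 := by
    intro k
    rw [mem_sphere_zero_iff_norm, hηN]
    dsimp only
    rw [norm_smul, norm_inv, norm_norm, inv_mul_cancel₀ (hρpos k).ne']
  obtain ⟨e, he, ψ, hψ, hηe⟩ := (isCompact_sphere (0 : E3) 1).tendsto_subseq hηN_mem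
  have he1 : ‖e‖ = 1 := mem_sphere_zero_iff_norm.1 he
  have harg1 : ∀ k, T + β * (Rz k ^ 2 * sN k) = t k := by
    intro k
    have h1 : Rz k ≠ 0 := (hRz_pos k).ne'
    simp only [hsN]
    field_simp
    ring
  have harg2 : ∀ k, a + R • (Rz k • ηN k) = x k := by
    intro k
    have h1 : ‖x k - a‖ ≠ 0 := (hρpos k).ne'
    simp only [hRz, hηN, smul_smul]
    rw [show R * (‖x k - a‖ / R * ‖x k - a‖⁻¹) = 1 by field_simp, one_smul, add_sub_cancel]
  have hval : ∀ k, Rz k * ‖v ((0 : ℝ × E3).1 + Rz k ^ 2 * sN k) ((0 : ℝ × E3).2 + Rz k • ηN k)‖ =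
      (α / R) * (‖x k - a‖ * ‖u (t k) (x k)‖) := by
    intro k
    rw [Prod.fst_zero, Prod.snd_zero, zero_add, zero_add, hv, smul_stPull_apply, harg1, harg2,
      norm_smul, Real.norm_of_nonneg hα.le, hRz]
    ring
  have hsat : Tendsto (fun n => Rz (ψ n) *
      ‖v ((0 : ℝ × E3).1 + Rz (ψ n) ^ 2 * sN (ψ n)) ((0 : ℝ × E3).2 + Rz (ψ n) • ηN (ψ n))‖)
      atTop atTop := by
    simp only [hval]
    exact (hprod.comp hψ.tendsto_atTop).const_mul_atTop (div_pos hα hR)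
  -- ## (6) the twin zoom limit carrying the budget
  obtain ⟨U, P, H, hTI', hInBall, -, -, -, hsing0, hsinge, hbudU⟩ :=
    exists_typeIAncientMild_twinZoomLimit_budget (z₀ := (0 : ℝ × E3)) (M := C₁) hρ' hball' hGv'
      hI' hvc' hrate' hsing (div_pos hδb hβ) (div_pos hr₀b hR) hbudv
      (R := fun n => Rz (ψ n)) (fun n => hRz_pos (ψ n)) (hRz0.comp hψ.tendsto_atTop)
      (s := fun n => sN (ψ n)) (η := fun n => ηN (ψ n)) (e := e) he1 (fun n => hsN_neg (ψ n))
      (hsN0.comp hψ.tendsto_atTop) hηe hsat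
  -- ## (7) the tame twin-scar object
  refine ⟨C₁, U, hTI', ?_, e, he1, singularAt_of_isBackwardSingularPoint hsinge, ?_⟩
  · exact singularAt_of_isBackwardSingularPoint
      (show IsBackwardSingularPoint U (((0 : ℝ), (0 : E3)) : ℝ × E3) from hsing0)
  · exact essClassAt_of_inBall_of_budget (ENNReal.mul_ne_top (by simp) hqbtop)
      (hInBall 2 two_pos) hbudU he1

end Summit.NavierStokesRegularity.NavierStokesRegularity.Cruxes.ScarEnvelopeTypeI.SliceBudget

end
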